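import Mathlib
import Summits.NavierStokesRegularity.NavierStokesRegularity.Theses.TypeIIInviscidRelaxation
import Literature.Analysis.FluidPDE.AxisymmetricEuler

/-!
# Birth skeleton of the piece `AprioriRadialInflowBound` (X₂; route item stmt-NavierStokesRegularity-19060)
of the decomposition of the crux `AxisymSwirlRegular` (stmt-NavierStokesRegularity-1964).

LINE "radial-momentum minimum principle": the radial momentum `Φ := x₀u₀ + x₁u₁ = r u_r` of a
classical solution satisfies, by a direct computation from the Navier–Stokes system (`div u = 0`),
`(∂ₜ + u·∇ − νΔ) Φ = f + 2ν ∂_z u_z`, `f := |u_h|² − x_h·∇_h p = u_r² + u_θ² − r ∂ᵣ p`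
(the CYCLOSTROPHIC DEFECT: in cyclostrophic balance `∂ᵣ p = u_θ²/r` it vanishes), and for
axisymmetric `u` one has `∂_z u_z = −(1/r) ∂ᵣ Φ`, which vanishes at an interior spatial minimum of
`Φ(t,·)`; `Φ = 0` on the axis. Hence `t ↦ min Φ(t,·)` over an axis tube decreases at most at rate
`(−f)⁺` at the minimum point, or sits on the lateral boundary `{r = δ}` where `Φ ≥ −δM` by off-axis
boundedness. So: a floor `f ≥ −g(t)` on the tube with `g ∈ L¹(0,T)` (`stub_cyclostrophicDefectFloor`,
the OPEN content — a one-sided statement about the pressure, not about `u_r`), the minimum principle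
(`stub_radialMomentumMinPrinciple`, provable analysis) and off-axis boundedness up to `T`
(`stub_offAxisBound`, known: CKN partial regularity off the axis for axisymmetric suitable solutions +
far field) give `Φ ≥ −Cν` on the tube, i.e. the piece.

`AprioriRadialInflowBound_of` is proved from the three stub statements (sorries only inside `stub_*`).
-/

namespace Summit.NavierStokesRegularity.NavierStokesRegularity.Cruxes.AxisymSwirlRegular.AprioriRadialInflowBoundBirth

open Literature.Analysis.FluidPDE Set

/-- The piece X₂ (verbatim the route item stmt-NavierStokesRegularity-19060). -/
def AprioriRadialInflowBound : Prop :=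
  ∀ (ν T : ℝ), 0 < ν → 0 < T → ∀ (u : ℝ → EuclideanSpace ℝ (Fin 3) → EuclideanSpace ℝ (Fin 3)) (p : ℝ → EuclideanSpace ℝ (Fin 3) → ℝ), Literature.Analysis.FluidPDE.IsClassicalNSSolutionOn (Set.Ico 0 T) ν 0 u p → Literature.Analysis.FluidPDE.IsLerayHopfOn T ν 0 (u 0) u → (∀ T' < T, ∃ M : ℝ, ∀ t ∈ Set.Icc 0 T', ∀ x, ‖u t x‖ ≤ M) → (∀ t ∈ Set.Ico 0 T, Literature.Analysis.FluidPDE.IsAxisymmetric (u t)) → Literature.Analysis.FluidPDE.HasRapidSpatialDecay (u 0) → ∃ C δ : ℝ, 0 < δ ∧ ∀ t ∈ Set.Ico 0 T, ∀ x, Literature.Analysis.FluidPDE.cylRadius x < δ → -(C * ν) ≤ x 0 * u t x 0 + x 1 * u t x 1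

/-- **S1 (OPEN, the content): an `L¹`-in-time floor for the cyclostrophic defect near the axis.** In the
standing class there are `δ > 0` and `g ∈ L¹(0,T)` with
`f(t,x) = (u₀² + u₁²)(t,x) − (x₀ ∂₀p + x₁ ∂₁p)(t,x) ≥ −g(t)` on `{cylRadius < δ} × [0,T)`: the inward
radial pressure pull `r∂ᵣp` never exceeds the centrifugal + radial kinetic term `u_θ² + u_r²` by more
than an integrable-in-time amount. A statement about the PRESSURE (nonlocal), not about `u_r`; in
Hou's scenario the inflow jet is pressure driven, so this is where that scenario is confronted.
Why it might fail: a suction core on the axis (`p(axis) ≪ p(r)`) deepening at a non-integrable rate. -/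
theorem stub_cyclostrophicDefectFloor :
    ∀ (ν T : ℝ), 0 < ν → 0 < T → ∀ (u : ℝ → EuclideanSpace ℝ (Fin 3) → EuclideanSpace ℝ (Fin 3)) (p : ℝ → EuclideanSpace ℝ (Fin 3) → ℝ), Literature.Analysis.FluidPDE.IsClassicalNSSolutionOn (Set.Ico 0 T) ν 0 u p → Literature.Analysis.FluidPDE.IsLerayHopfOn T ν 0 (u 0) u → (∀ T' < T, ∃ M : ℝ, ∀ t ∈ Set.Icc 0 T', ∀ x, ‖u t x‖ ≤ M) → (∀ t ∈ Set.Ico 0 T, Literature.Analysis.FluidPDE.IsAxisymmetric (u t)) → Literature.Analysis.FluidPDE.HasRapidSpatialDecay (u 0) → ∃ (δ : ℝ) (g : ℝ → ℝ), 0 < δ ∧ MeasureTheory.IntegrableOn g (Set.Ico 0 T) ∧ ∀ t ∈ Set.Ico 0 T, ∀ x, Literature.Analysis.FluidPDE.cylRadius x < δ → -g t ≤ (u t x 0) ^ 2 + (u t x 1) ^ 2 - (x 0 * fderiv ℝ (p t) x (EuclideanSpace.single (0 : Fin 3) (1 : ℝ)) + x 1 * fderiv ℝ (p t) x (EuclideanSpace.single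 (1 : Fin 3) (1 : ℝ))) := by
  sorry

/-- **S2 (PROVABLE ANALYSIS, L-sized): the radial-momentum minimum principle.** In the standing class,
an `L¹`-in-time floor for the cyclostrophic defect on an axis tube (the conclusion of S1, for this
solution) and boundedness off every axis tube up to `T` (the conclusion of S3) imply the one-sided
inflow bound `x₀u₀ + x₁u₁ ≥ −Cν` on a tube. Proof sketch: `Φ = x₀u₀ + x₁u₁` satisfies
`(∂ₜ + u·∇ − νΔ)Φ = f + 2ν∂_z u_z` (direct computation, `div u = 0`); for axisymmetric slices
`∂_z u_z = −(x_h·∇_h Φ)/r²` vanishes where `∇Φ = 0`; `Φ = 0` on the axis, `Φ ≥ −δM` on `{r = δ}`,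
`Φ(t,·) → 0` at spatial infinity inside the tube (bounded-energy classical solution, bounded with
bounded gradient on sub-slabs); so `m(t) = min_{r ≤ δ} Φ(t,·)` has Dini derivative `≥ −g(t)` whenever
`m(t) < −δM`, whence `m ≥ min (m(0), −δM) − ‖g⁺‖₁ =: −Cν`. -/
theorem stub_radialMomentumMinPrinciple :
    ∀ (ν T : ℝ), 0 < ν → 0 < T → ∀ (u : ℝ → EuclideanSpace ℝ (Fin 3) → EuclideanSpace ℝ (Fin 3)) (p : ℝ → EuclideanSpace ℝ (Fin 3) → ℝ), Literature.Analysis.FluidPDE.IsClassicalNSSolutionOn (Set.Ico 0 T) ν 0 u p → Literature.Analysis.FluidPDE.IsLerayHopfOn T ν 0 (u 0) u → (∀ T' < T, ∃ M : ℝ, ∀ t ∈ Set.Icc 0 T', ∀ x, ‖u t x‖ ≤ M) → (∀ t ∈ Set.Ico 0 T, Literature.Analysis.FluidPDE.IsAxisymmetric (u t)) → Literature.Analysis.FluidPDE.HasRapidSpatialDecay (u 0) → (∃ (δ : ℝ) (g : ℝ → ℝ), 0 < δ ∧ MeasureTheory.IntegrableOn g (Set.Ico 0 T) ∧ ∀ t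 ∈ Set.Ico 0 T, ∀ x, Literature.Analysis.FluidPDE.cylRadius x < δ → -g t ≤ (u t x 0) ^ 2 + (u t x 1) ^ 2 - (x 0 * fderiv ℝ (p t) x (EuclideanSpace.single (0 : Fin 3) (1 : ℝ)) + x 1 * fderiv ℝ (p t) x (EuclideanSpace.single (1 : Fin 3) (1 : ℝ)))) → (∀ δ₀ : ℝ, 0 < δ₀ → ∃ M : ℝ, ∀ t ∈ Set.Ico 0 T, ∀ x, δ₀ ≤ Literature.Analysis.FluidPDE.cylRadius x → ‖u t x‖ ≤ M) → ∃ C δ : ℝ, 0 < δ ∧ ∀ t ∈ Set.Ico 0 T, ∀ x, Literature.Analysis.FluidPDE.cylRadius x < δ → -(C * ν) ≤ x 0 * u t x 0 + x 1 * u t x 1 := by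
  sorry

/-- **S3 (KNOWN MATHEMATICS, L-sized in Lean, largely in tree): boundedness off every axis tube up to
`T`.** In the standing class, for every `δ₀ > 0` the velocity is bounded on `{cylRadius ≥ δ₀} × [0,T)`:
on `[0, T/2]` by the sub-slab bound; near `T` and `|x| ≤ R` because every point `(T, x)` off the axis
is regular (the singular set of an axisymmetric suitable weak solution lies on the axis — CKN's
`𝒫¹(S) = 0` plus rotation invariance; Seregin–Šverák 2009 §3; tree `SereginSverakOffAxis*`,
`AxisymmetricSingularSetOnAxis`) and regular points are locally uniformly bounded; for `|x| > R` by
far-field regularity from the rapidly decaying datum (CKN Thm D; tree `KatoFarFieldBound`,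
`LerayFarFieldRegularity`). -/
theorem stub_offAxisBound :
    ∀ (ν T : ℝ), 0 < ν → 0 < T → ∀ (u : ℝ → EuclideanSpace ℝ (Fin 3) → EuclideanSpace ℝ (Fin 3)) (p : ℝ → EuclideanSpace ℝ (Fin 3) → ℝ), Literature.Analysis.FluidPDE.IsClassicalNSSolutionOn (Set.Ico 0 T) ν 0 u p → Literature.Analysis.FluidPDE.IsLerayHopfOn T ν 0 (u 0) u → (∀ T' < T, ∃ M : ℝ, ∀ t ∈ Set.Icc 0 T', ∀ x, ‖u t x‖ ≤ M) → (∀ t ∈ Set.Ico 0 T, Literature.Analysis.FluidPDE.IsAxisymmetric (u t)) → Literature.Analysis.FluidPDE.HasRapidSpatialDecay (u 0) → ∀ δ₀ : ℝ, 0 < δ₀ → ∃ M : ℝ, ∀ t ∈ Set.Ico 0 T, ∀ x, δ₀ ≤ Literature.Analysis.FluidPDE.cylRadius x → ‖u t x‖ ≤ M := by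
  sorry

/-- **The piece from the stubs**: minimum principle (S2) fed by the defect floor (S1) and the off-axis
bound (S3). -/
theorem AprioriRadialInflowBound_of : AprioriRadialInflowBound := by
  intro ν T hν hT u p hcl hLH hbd hax hdec
  exact stub_radialMomentumMinPrinciple ν T hν hT u p hcl hLH hbd hax hdec
    (stub_cyclostrophicDefectFloor ν T hν hT u p hcl hLH hbd hax hdec)
    (stub_offAxisBound ν T hν hT u p hcl hLH hbd hax hdec)

end Summit.NavierStokesRegularity.NavierStokesRegularity.Cruxes.AxisymSwirlRegular.AprioriRadialInflowBoundBirth
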